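/-
Copyright (c) 2026 the pub-hodgecm-mathlib formalisation cell (harness21).  Prover seat hodgecm-mathlib-LH4-p07 (g7), Track A «(D-RAM) FOUR-FRAME», unit U2H, the census leaf
(ρ2b′-X) `stub_U2H_fixedPointCensus_typeTwo_unit0` — seam S2′-R «RAMIFIED THIRD-FIELD PACKAGE», the RamK ADAPTERS (LH4-p12 (g5) 06:20:37Z hand; payer LH4-p14 (g4) MAP v2 S6-RK):
the ★ T5b level tables of type RamK with the third-field binders DISCHARGED by ★ `exists_valuedFixedField_ramified`.  2026-09-04.
-/
import Summits.HodgeConjecture.HodgeConjecture.Theorems.F0P3cDyRamToricLevelCensusRamKHyper       -- ★ p857727 (F0P3-p01 (g32)) T5b (S3) `ncard_levelSet_ramK_hyper`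
import Summits.HodgeConjecture.HodgeConjecture.Theorems.F0P3cDyRamToricLevelCensusRamKAniso       -- ★ (F0P3-p01 (g32)) T5b (S4) `ncard_levelSet_ramK_aniso`
import Summits.HodgeConjecture.HodgeConjecture.Theorems.F0P3cDyRamToricLevelCensusRamKTop         -- ★ (F0P3-p01 (g32)) T5b (D3) `ncard_levelSetDep_top_mul_eq_of_ramK`
import Summits.HodgeConjecture.HodgeConjecture.Theorems.F0P3cDyRamTypeUThirdFieldDichotomy        -- ★ p857868 (LH4-p05 (g4)) `v_sub_map_lt_one_of_ramK`
import Literature.NumberTheory.LocalFields.ValuedFixedFieldRamified                               -- ★ S2′-R (LH4-p12 (g5)) `exists_valuedFixedField_ramified`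
import Literature.NumberTheory.LocalFields.QuadraticDatumNormsOfDoublyFixedUnitsThirdField               -- ★ (F0P3-p01 (g32)) `exists_mul_map_eq_of_fixed_fixed_of_thirdField` (ED. 2)
import HarnessLib

/-!
# T5b at the frame, type RamK: the third field DISCHARGED (S2′-R adapters)

The three ★ T5b heads of the type-RamK toric level census (F0P3-p01 (g32): the hyperbolic table `ncard_levelSet_ramK_hyper`, the anisotropic table
`ncard_levelSet_ramK_aniso`, the top count `ncard_levelSetDep_top_mul_eq_of_ramK`) take the third field `K♮ = Fix Θ` ABSTRACTLY, through one and the same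
block of binders: a complete discretely valued field `K'` with finite residue field of size `q²`, an unramified involution `σ'` with a unit-depth element
`α'` (`|α'| ≤ 1`, `|α' − σ'α'| = 1`), a uniformiser `π'`, and an embedding `jK : K' →+* K` DOUBLING valuations (`|jK x| = |x|²`) onto the `Θ`-fixed elements
with `jK ∘ σ' = ρ ∘ jK`.  ★ S2′-R `Literature.NumberTheory.LocalFields.ValuedFixedFieldRamified.exists_valuedFixedField_ramified` (LH4-p12 (g5), route (b′):
`K' := Fix Θ` as a type with the halved valuation) PRODUCES such a field from the one-field frame once `Θ` is residually trivial and its fixed elements have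
even order.

THIS FILE is the consumer-side seam for type RamK.  §1 `exists_thirdFieldPackage_ramK` assembles EXACTLY the T5b block from the rows' own M-side letters
(`hρρ hvρ hΘρ hα1 hα`, the Θ-datum `hD`, `#𝓀[K] = q²`) plus two case letters: `hσres` (Θ is residually trivial on `Fix ρ = E` — the E-datum is ramified)
and the RamK case-definer `hram : |α − Θα| < 1`; the inputs of ★ S2′-R are discharged by ★ `v_sub_map_lt_one_of_ramK` (residual triviality of Θ on all of
`𝒪_M`), the clauses of `hD`, and `P := ϖE·ΘϖE`; the unit-depth element `α'` is the residue-surjectivity witness at `α`, its depth read through the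
order-isomorphism clause.  §2 restates the three ★ rows with the `K'`-block REPLACED by `hσres hram`, bodies `obtain … := exists_thirdFieldPackage_ramK …;
exact ★row …`; conclusions byte for byte.
HONEST LABEL: HC_CM is proved only modulo the 7 printed citations (2 remaining named inputs: hLiu418 = stmt-HodgeConjecture-24832,
h413 = stmt-HodgeConjecture-24833) until rung 0 closes; (ρ2b′-X) :418 is an OPEN prover target — this file is a helper (`--supports`), proofs only, closes no socket.
-/

set_option autoImplicit false

open WithZero IsLocalRing
open scoped Valued

namespace Summit.HodgeConjecture.HodgeConjecture.Cruxes.H413.F0P3cDyRamToricLevelCensusRamKAtThirdField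

open Summit.HodgeConjecture.HodgeConjecture.Cruxes.H413.F0P3cDyRamToricCensusDefs
open Summit.HodgeConjecture.HodgeConjecture.Cruxes.H413.F0P3cDyRamToricLevelCensusRamK
open Summit.HodgeConjecture.HodgeConjecture.Cruxes.H413.F0P3cDyRamTypeUThirdFieldDichotomy (v_sub_map_lt_one_of_ramK)
open Literature.NumberTheory.LocalFields.ValuedFixedFieldRamified (exists_valuedFixedField_ramified)
open Literature.NumberTheory.Automorphic.UnitaryThreeFourFrame

variable {K : Type} [Field K] [Valued K ℤᵐ⁰] {ρ Θ : K →+* K} {α ϖE h : K}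

/-! ## §1 The type-RamK third-field package at the T5b letters -/

/-- **THE TYPE-RamK THIRD-FIELD PACKAGE AT THE T5b LETTERS.**  In the one-field frame of type RamK — `ρ` an isometric involution commuting with `Θ`, `α` of unit
`ρ`-depth (`M∕E` unramified), a ramified Θ-datum `(Θ, ϖE, d, t)`, `#𝓀[K] = q²`, `K` complete — with `Θ` residually trivial on `Fix ρ` (`hσres`) and the RamK
case-definer `|α − Θα| < 1` (`hram`), there is a complete discretely valued field `K'` with `#𝓀[K'] = q²`, an isometric involution `σ'`, an element `α'` with
`|α'| ≤ 1`, `|α' − σ'α'| = 1`, a uniformiser `π'`, and `jK : K' →+* K` with `|jK x| = |x|²` onto the `Θ`-fixed elements, `jK ∘ σ' = ρ ∘ jK` — the binder block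
of the ★ T5b heads VERBATIM (★ S2′-R at `P := ϖE·ΘϖE`, `α'` := the residue-surjectivity witness at `α`). [cite: Serre1979, Ch. II §3, Ch. III §5] -/
theorem exists_thirdFieldPackage_ramK [CompleteSpace K] [Finite 𝓀[K]]
    (hρρ : ∀ x, ρ (ρ x) = x) (hvρ : ∀ x, Valued.v (ρ x) = Valued.v x) (hΘρ : ∀ x, Θ (ρ x) = ρ (Θ x))
    (hα1 : Valued.v α ≤ 1) (hα : Valued.v (α - ρ α) = 1) {d t : ℕ} (hD : IsRamifiedQuadraticDatum Θ ϖE d t)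
    {q : ℕ} (hq : Nat.card 𝓀[K] = q ^ 2)
    (hσres : ∀ z : K, ρ z = z → Valued.v z ≤ 1 → Valued.v (Θ z - z) < 1) (hram : Valued.v (α - Θ α) < 1) :
    ∃ (K' : Type) (_ : Field K') (_ : Valued K' ℤᵐ⁰) (σ' : K' →+* K') (α' π' : K') (jK : K' →+* K),
      IsDiscreteValuationRing 𝒪[K'] ∧ Finite 𝓀[K'] ∧ CompleteSpace K' ∧
      (∀ x, σ' (σ' x) = x) ∧ (∀ x, Valued.v (σ' x) = Valued.v x) ∧ Valued.v α' ≤ 1 ∧ Valued.v (α' - σ' α') = 1 ∧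
      Valued.v π' = exp (-1 : ℤ) ∧ Nat.card 𝓀[K'] = q ^ 2 ∧
      (∀ x, Valued.v (jK x) = Valued.v x ^ 2) ∧ (∀ x, Θ (jK x) = jK x) ∧ (∀ z : K, Θ z = z → ∃ x, jK x = z) ∧
      (∀ x, jK (σ' x) = ρ (jK x)) := by
  obtain ⟨hΘΘ, hvΘ, hϖE, hev, -, -, -⟩ := hD
  have hΘres : ∀ x : K, Valued.v x ≤ 1 → Valued.v (x - Θ x) < 1 :=
    fun x hx => v_sub_map_lt_one_of_ramK hρρ hvρ hvΘ hσres hα1 hα hram x hx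
  have hΘP : Θ (ϖE * Θ ϖE) = ϖE * Θ ϖE := by rw [map_mul, hΘΘ, mul_comm]
  have hP : Valued.v (ϖE * Θ ϖE) = exp (-2 : ℤ) := by
    rw [map_mul, hvΘ, hϖE, ← exp_add]; norm_num
  obtain ⟨K', _iF, _iV, σ', π', jK, hDVR, hfin, hcard, hcs, hσ', hvσ', hjv, hjle, hjΘ, hjfix, hjσ, hπ', -, hres⟩ :=
    exists_valuedFixedField_ramified hΘΘ hvΘ hΘres hev hρρ hvρ hΘρ hΘP hP
  obtain ⟨α', hα'1, hαα'⟩ := hres α hα1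
  refine ⟨K', _iF, _iV, σ', α', π', jK, hDVR, hfin, hcs, hσ', hvσ', hα'1, ?_, hπ', by rw [hcard, hq], hjv, hjΘ, hjfix, hjσ⟩
  -- `|α' − σ'α'| = 1`: `jK α' − ρ(jK α') = (α − ρα) + (ρ(α − jKα') − (α − jKα'))`, first summand a unit, second small
  have hsmall : Valued.v (ρ (α - jK α') - (α - jK α')) < 1 :=
    (Valuation.map_sub _ _ _).trans_lt (max_lt (by rwa [hvρ]) hαα')
  have hlt : Valued.v (ρ (α - jK α') - (α - jK α')) < Valued.v (α - ρ α) := by rw [hα]; exact hsmall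
  have h1 : Valued.v (jK (α' - σ' α')) = Valued.v (jK 1) := by
    rw [map_sub, hjσ, map_one, show jK α' - ρ (jK α') = (α - ρ α) + (ρ (α - jK α') - (α - jK α')) by rw [map_sub]; ring,
      Valuation.map_add_eq_of_lt_left _ hlt, hα, Valuation.map_one]
  exact le_antisymm (((hjle _ _).1 h1.le).trans_eq (Valuation.map_one _)) ((Valuation.map_one _).symm.trans_le ((hjle _ _).1 h1.ge))

/-! ## §2 The three ★ T5b rows at the frame (third field discharged) -/

/-- **T5b HYPERBOLIC TABLE AT THE FRAME, TYPE RamK** (★ `ncard_levelSet_ramK_hyper` with the third field supplied by §1): the u-free level table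
`#levelSet(j,a)` of a HYPERBOLIC hermitian scalar in closed form `(q, d)` — sheet (S3) verbatim. [cite: Flicker1998UnitaryFL, Prop. 7 p. 84]
[cite: Serre1979, Ch. V §3] [cite: Kottwitz1986BaseChangeUnits, §1 pp. 240–241] -/
theorem ncard_levelSet_ramK_hyper_of_frame [CompleteSpace K] [IsDiscreteValuationRing 𝒪[K]] [Finite 𝓀[K]]
    (hρρ : ∀ x, ρ (ρ x) = x) (hvρ : ∀ x, Valued.v (ρ x) = Valued.v x) (hΘρ : ∀ x, Θ (ρ x) = ρ (Θ x))
    (hα1 : Valued.v α ≤ 1) (hα : Valued.v (α - ρ α) = 1) {d t : ℕ} (hD : IsRamifiedQuadraticDatum Θ ϖE d t) (hρϖ : ρ ϖE = ϖE)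
    (hΘh : Θ h = h) (hh : h ≠ 0) {q : ℕ} (hq : Nat.card 𝓀[K] = q ^ 2)
    (hσres : ∀ z : K, ρ z = z → Valued.v z ≤ 1 → Valued.v (Θ z - z) < 1) (hram : Valued.v (α - Θ α) < 1)
    (hhyper : ∃ x : K, x ≠ 0 ∧ h * Θ x * x + ρ (h * Θ x * x) = 0) (j a : ℕ) :
    (levelSet ρ Θ α ϖE h j a).ncard =
      if j = 0 then (if a = 0 then 1 else 0)
      else if j < a ∨ (j - a) % 2 = 1 then 0
      else if a = j then (if 2 ≤ d then q ^ j else (q - 1) * q ^ (j - 1))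
      else if a = 0 then (if 2 * d ≤ j + 1 then 2 else 1) * q ^ (j / 2)
      else if j - a + 2 < 2 * d then (q - 1) * q ^ (j - 1 - (j - a) / 2)
      else if j - a + 2 = 2 * d then (q - 2) * q ^ (j - d)
      else 2 * (q - 1) * q ^ (j - 1 - (j - a) / 2) := by
  obtain ⟨K', _iF, _iV, σ', α', π', jK, hDVR, hfin, hcs, hσ', hvσ', hα'1, hα', hπ', hq', hjv, hjΘ, hjfix, hjσ⟩ :=
    exists_thirdFieldPackage_ramK hρρ hvρ hΘρ hα1 hα hD hq hσres hram
  haveI := hDVR; haveI := hfin; haveI := hcs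
  exact ncard_levelSet_ramK_hyper hρρ hvρ hΘρ hα1 hα hD hρϖ hΘh hh hq hσ' hvσ' hα'1 hα' hπ' hq' jK hjv hjΘ hjfix hjσ hhyper j a

/-- **T5b ANISOTROPIC TABLE AT THE FRAME, TYPE RamK** (★ `ncard_levelSet_ramK_aniso`, third field by §1): the u-free level table of an ANISOTROPIC
hermitian scalar — sheet (S4) verbatim. [cite: Flicker1998UnitaryFL, Prop. 7 p. 84] [cite: Serre1979, Ch. V §3] [cite: Kottwitz1986BaseChangeUnits, §1 pp. 240–241] -/
theorem ncard_levelSet_ramK_aniso_of_frame [CompleteSpace K] [IsDiscreteValuationRing 𝒪[K]] [Finite 𝓀[K]]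
    (hρρ : ∀ x, ρ (ρ x) = x) (hvρ : ∀ x, Valued.v (ρ x) = Valued.v x) (hΘρ : ∀ x, Θ (ρ x) = ρ (Θ x))
    (hα1 : Valued.v α ≤ 1) (hα : Valued.v (α - ρ α) = 1) {d t : ℕ} (hD : IsRamifiedQuadraticDatum Θ ϖE d t) (hρϖ : ρ ϖE = ϖE)
    (hΘh : Θ h = h) (hh : h ≠ 0) {q : ℕ} (hq : Nat.card 𝓀[K] = q ^ 2)
    (hσres : ∀ z : K, ρ z = z → Valued.v z ≤ 1 → Valued.v (Θ z - z) < 1) (hram : Valued.v (α - Θ α) < 1)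
    (haniso : ¬ ∃ x : K, x ≠ 0 ∧ h * Θ x * x + ρ (h * Θ x * x) = 0) (j a : ℕ) :
    (levelSet ρ Θ α ϖE h j a).ncard =
      if j = 0 then (if a = 0 then 1 else 0)
      else if j < a ∨ (j - a) % 2 = 1 then 0
      else if a = j then (if 2 ≤ d then q ^ j else (q + 1) * q ^ (j - 1))
      else if a = 0 then (if j + 2 ≤ 2 * d then q ^ (j / 2) else 0)
      else if j - a + 2 < 2 * d then (q - 1) * q ^ (j - 1 - (j - a) / 2)
      else if j - a + 2 = 2 * d then q ^ (j - d + 1)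
      else 0 := by
  obtain ⟨K', _iF, _iV, σ', α', π', jK, hDVR, hfin, hcs, hσ', hvσ', hα'1, hα', hπ', hq', hjv, hjΘ, hjfix, hjσ⟩ :=
    exists_thirdFieldPackage_ramK hρρ hvρ hΘρ hα1 hα hD hq hσres hram
  haveI := hDVR; haveI := hfin; haveI := hcs
  exact ncard_levelSet_ramK_aniso hρρ hvρ hΘρ hα1 hα hD hρϖ hΘh hh hq hσ' hvσ' hα'1 hα' hπ' hq' jK hjv hjΘ hjfix hjσ haniso j a

open scoped Classical in
/-- **T5b TOP COUNT AT THE FRAME, TYPE RamK, INDEX FORM** (★ `ncard_levelSetDep_top_mul_eq_of_ramK`, third field by §1): on the top half of the diagonal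
(`1 ≤ a ≤ j`, `a ≤ m`, `j + m = jλ + a`, `m + 1 ≤ 2a`, `j ≡ a (2)`), `#levelSetDep(j,a;μ) · idxRK(q,d,j+a−m) = (q+1)q^(j−1) · bit`.
[cite: Flicker1998UnitaryFL, Prop. 7 p. 84] [cite: Jacobowitz1962, §4] [cite: Serre1979, Ch. V §3] -/
theorem ncard_levelSetDep_top_mul_eq_of_ramK_of_frame [CompleteSpace K] [IsDiscreteValuationRing 𝒪[K]] [Finite 𝓀[K]]
    (hρρ : ∀ x, ρ (ρ x) = x) (hvρ : ∀ x, Valued.v (ρ x) = Valued.v x) (hΘρ : ∀ x, Θ (ρ x) = ρ (Θ x))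
    (hα1 : Valued.v α ≤ 1) (hα : Valued.v (α - ρ α) = 1) {d t : ℕ} (hD : IsRamifiedQuadraticDatum Θ ϖE d t) (hρϖ : ρ ϖE = ϖE)
    (hΘh : Θ h = h) (hh : h ≠ 0) {q : ℕ} (hq : Nat.card 𝓀[K] = q ^ 2)
    (hσres : ∀ z : K, ρ z = z → Valued.v z ≤ 1 → Valued.v (Θ z - z) < 1) (hram : Valued.v (α - Θ α) < 1)
    {μ : K} {m jl : ℕ} (hm : Valued.v μ = exp (-(m : ℤ))) (hjl : Valued.v (μ - ρ μ) = exp (-(jl : ℤ)))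
    {j a : ℕ} (ha : 1 ≤ a) (haj : a ≤ j) (ham : a ≤ m) (hdiag : j + m = jl + a) (htop : m + 1 ≤ 2 * a) (hpar : (j + a) % 2 = 0) :
    (levelSetDep ρ Θ α ϖE h j a μ).ncard *
        (if j + a - m = 0 then 1 else if j + a - m + 2 ≤ 2 * d then (q + 1) * q ^ ((j + a - m + 1) / 2 - 1)
          else (q + 1) * q ^ ((j + a - m + 1) / 2 - 1) / 2) =
      if ∃ ω₁ : Kˣ, Valued.v (ω₁ : K) = 1 ∧
        Valued.v (1 + ρ h / h / (ρ μ / μ) * (ρ ((ω₁ : K) * Θ ω₁) / ((ω₁ : K) * Θ ω₁))) ≤ exp (-((j + a : ℕ) - (m : ℤ)))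
      then (q + 1) * q ^ (j - 1) else 0 := by
  obtain ⟨K', _iF, _iV, σ', α', π', jK, hDVR, hfin, hcs, hσ', hvσ', hα'1, hα', hπ', hq', hjv, hjΘ, hjfix, hjσ⟩ :=
    exists_thirdFieldPackage_ramK hρρ hvρ hΘρ hα1 hα hD hq hσres hram
  haveI := hDVR; haveI := hfin; haveI := hcs
  exact ncard_levelSetDep_top_mul_eq_of_ramK hρρ hvρ hΘρ hα1 hα hD hρϖ hΘh hh hq hσ' hvσ' hα'1 hα' hπ' hq' jK hjv hjΘ hjfix hjσ
    hm hjl ha haj ham hdiag htop hpar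

/-! ## §3 (ED. 2) The `hFN` conjunct of socket (B): doubly fixed units are hermitian norms, type RamK, at the frame -/

/-- **`hFN` ON TYPE RamK AT THE FRAME** (ED. 2; socket (B)'s first conjunct, lead LH4-p07 (g7)).  In the one-field RamK frame (`hρρ hvρ hΘρ`, `|α| ≤ 1`, `|α − ρα| = 1`,
Θ-datum `hD`, `#𝓀 = q²`, `K` complete) with the case letters `hσres`, `hram`: EVERY unit of `K = M` fixed by `ρ` and `Θ` is a hermitian norm `z·Θz` — ★ two-field
`exists_mul_map_eq_of_fixed_fixed_of_thirdField` (F0P3-p01 (g32): ρ-averaging + `𝒪_{K♮}ˣ ⊆ N(𝒪_Mˣ)` for the ramified `M∕K♮`) with its third-field letters supplied by §1.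
[cite: Serre1979, Ch. V §2 Prop. 3; Ch. V §3 Cor. 3] [cite: NeukirchANT1999, Ch. V (1.3)–(1.4)] -/
theorem exists_mul_theta_eq_of_fixed_fixed_of_frame [CompleteSpace K] [Finite 𝓀[K]]
    (hρρ : ∀ x, ρ (ρ x) = x) (hvρ : ∀ x, Valued.v (ρ x) = Valued.v x) (hΘρ : ∀ x, Θ (ρ x) = ρ (Θ x))
    (hα1 : Valued.v α ≤ 1) (hα : Valued.v (α - ρ α) = 1) {d t : ℕ} (hD : IsRamifiedQuadraticDatum Θ ϖE d t)
    {q : ℕ} (hq : Nat.card 𝓀[K] = q ^ 2)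
    (hσres : ∀ z : K, ρ z = z → Valued.v z ≤ 1 → Valued.v (Θ z - z) < 1) (hram : Valued.v (α - Θ α) < 1)
    {f : K} (hρf : ρ f = f) (hΘf : Θ f = f) (hf : Valued.v f = 1) : ∃ z : K, z * Θ z = f := by
  obtain ⟨K', _iF, _iV, σ', α', π', jK, _hDVR, hfin, hcs, hσ', hvσ', hα'1, hα', hπ', -, hjv, hjΘ, hjfix, hjσ⟩ :=
    exists_thirdFieldPackage_ramK hρρ hvρ hΘρ hα1 hα hD hq hσres hram
  haveI := hfin; haveI := hcs
  exact Literature.NumberTheory.LocalFields.WildQuadraticDatum.exists_mul_map_eq_of_fixed_fixed_of_thirdField hρρ hvρ hΘρ hD hσ' hvσ' hα'1 hα' hπ'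
    jK hjv hjΘ hjfix hjσ hρf hΘf hf

/-- **THE `hFN` CLAUSE OF SOCKET (B), QUANTIFIED FORM** (ED. 2): `∀ f, ρ f = f → Θ f = f → |f| = 1 → ∃ z, z·Θz = f` on the type-RamK frame — the shape socket (B)'s first
conjunct prints. [cite: Serre1979, Ch. V §2 Prop. 3; Ch. V §3 Cor. 3] -/
theorem forall_fixed_fixed_exists_mul_theta_eq_of_frame [CompleteSpace K] [Finite 𝓀[K]]
    (hρρ : ∀ x, ρ (ρ x) = x) (hvρ : ∀ x, Valued.v (ρ x) = Valued.v x) (hΘρ : ∀ x, Θ (ρ x) = ρ (Θ x))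
    (hα1 : Valued.v α ≤ 1) (hα : Valued.v (α - ρ α) = 1) {d t : ℕ} (hD : IsRamifiedQuadraticDatum Θ ϖE d t)
    {q : ℕ} (hq : Nat.card 𝓀[K] = q ^ 2)
    (hσres : ∀ z : K, ρ z = z → Valued.v z ≤ 1 → Valued.v (Θ z - z) < 1) (hram : Valued.v (α - Θ α) < 1) :
    ∀ f : K, ρ f = f → Θ f = f → Valued.v f = 1 → ∃ z : K, z * Θ z = f :=
  fun _ hρf hΘf hf => exists_mul_theta_eq_of_fixed_fixed_of_frame hρρ hvρ hΘρ hα1 hα hD hq hσres hram hρf hΘf hf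

end Summit.HodgeConjecture.HodgeConjecture.Cruxes.H413.F0P3cDyRamToricLevelCensusRamKAtThirdField
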